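import Summits.FinalStateConjecture.FinalStateConjecture.Theses.PhaseMixingCapture
import Summits.FinalStateConjecture.FinalStateConjecture.Theorems.NearExtremalKappaCapture.Negative.ExponentMonotonicity
import Summits.FinalStateConjecture.FinalStateConjecture.Theorems.NearExtremalKappaCapture.Negative.SubextremalRedundancy
import Summits.FinalStateConjecture.FinalStateConjecture.Theorems.PhaseMixingCaptureNearExtremalKappaCaptureUnitTemperatureFace
import Literature.Geometry.Lorentzian.KerrRedShiftBulk
import Literature.Geometry.Lorentzian.KerrConvergence

/-!
# Line `unit-temperature-front-face` — CANDIDATE RESHAPE (weighted hand-over), for the planner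

Lead prover-line-stmt-FinalStateConjecture-10606-1, 2026-08-16 (cycle 1 hand-back `promote-stub`). NOT registered; nothing here is a
stub of the live skeleton `Lines/unit-temperature-front-face.lean` (rev 2.1). Purpose: kernel-elaborated TEXT of the repair
recommended in `Cruxes/…/StubCaptureTransferLead.md` §2/§5.

Defect being repaired. S3 (`stub_thermalTimeStability`) hands S4 an UNWEIGHTED `Cᵏ` sup bound
(`Spacetime.deviationCk` = `supCkENorm` over the whole leaf `{t* = τ}`) — too weak for any restart of a stability/decay
argument at `t* = T/κ`, which needs WEIGHTED (decaying-in-`r`) control of the deviation and its derivatives. Repair: the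
hand-over `ThermalTimeOutputW` below states the same anchored chart with the weighted bound
`sup_{m ≤ k} sup_{x ∈ leaf τ} (1 + r(x))^{δ' + m} ‖D^m(Ψ^*g − g_{M,a})(x)‖ ≤ C χ^{−p} √dist`, where the consumer chooses the
output weight `δ'` (and order `k`, thermal time `T`) and the producer answers with input norms `(s, δ)` and exponents
`(γ, p, a₁)`. `S3ʷ := S1 → S2 → ThermalTimeOutputW`, `S4ʷ := ThermalTimeOutputW → KappaExplicitWaveDecay → ∃ exps, CaptureWithoutSub`;
the composition `NearExtremalKappaCapture_ofW` is the same plumbing as rev 2. `outputW_le` shows the weighted bound dominates the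
unweighted `deviationCk` at `δ' = 0` (weights `≥ 1`), so `S3ʷ ⇒ S3` clause-wise: the reshape is a strengthening of S3 and a
weakening of S4, as intended.
-/

noncomputable section

set_option linter.unusedVariables false
set_option linter.dupNamespace false

namespace Summit.FinalStateConjecture.FinalStateConjecture.Cruxes.NearExtremalKappaCapture.UnitTemperatureFrontFace.Weighted

open Summit.FinalStateConjecture.FinalStateConjecture.Theses.PhaseMixingCapture
open Summit.FinalStateConjecture.FinalStateConjecture.Theorems.NearExtremalKappaCapture.Negative
open Literature.Geometry.Lorentzian
open Set Filter
open scoped Topology Manifold ENNReal ContDiff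

/-- Statement of S1 (`stub_unitTemperatureFace`, LANDED p103018), by `type_of%` of the tree theorem. -/
abbrev S1 : Prop :=
  type_of% Summit.FinalStateConjecture.FinalStateConjecture.Theorems.NearExtremalKappaCapture.UnitTemperatureFrontFace.stub_unitTemperatureFace

/-- Statement of S2 (`stub_faceRedShift`, LANDED p104110; text verbatim from the skeleton — its module is not yet built on the
farm snapshot, so it is not imported here). -/
abbrev S2 : Prop :=
    (∀ M : ℝ, 0 < M → ∃ (N₁ : ℕ) (A θ₀ b : ℝ), 0 < θ₀ ∧ 0 < b ∧
      ∀ a : ℝ, Kerr.IsSubextremal M a → ∃ h₁ f₁ : ℝ,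
        |h₁| + |f₁| ≤ A * (Kerr.surfaceGravity M a)⁻¹ ^ N₁ ∧
        ∀ x : E4, |Kerr.radius a x - Kerr.rPlus M a| ≤ θ₀ * (Kerr.rPlus M a - Kerr.rMinus M a) →
          ∀ w : E4 → ℝ, DifferentiableAt ℝ w x →
            b * Kerr.surfaceGravity M a ^ N₁ *
                (Kerr.hawkingComp M a x (fun μ ↦ fderiv ℝ w x (E4.basisVector μ)) ^ 2 +
                  Kerr.frameIn a x (fun μ ↦ fderiv ℝ w x (E4.basisVector μ)) ^ 2 +
                  Kerr.frameAngSq a x ((fun μ ↦ fderiv ℝ w x (E4.basisVector μ)) +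
                    Kerr.frameIn a x (fun μ ↦ fderiv ℝ w x (E4.basisVector μ)) • Kerr.dRadius a x)) ≤
              KerrSchild.multiplierBulk (Kerr.inverseMetric M a) (Kerr.redShiftVector M a h₁ f₁) w x)

/-- **The weighted thermal-time hand-over** `ThermalTimeOutputW`: for every thermal time `T > 0`, order `k` and OUTPUT
WEIGHT `δ'` there are input norms `(s, δ)`, exponents `(γ, p)` and a threshold `a₁ < 1` such that, on the near-extremal range,
every vacuum datum within `dist_{s,δ} < c χ^γ` of `Kerr.data M a M` has, in every maximal development, an ANCHORED chart `Ψ`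
(smooth open embedding on `{0 < t* < T/κ + 1}`, continuous up to `t* = 0` where `Ψ(0,y) = ι y`) whose metric deviation from
`g_{M,a}` satisfies the WEIGHTED `Cᵏ` bound `sup_{m ≤ k} sup_{x ∈ {t* = τ}} (1 + r(x))^{δ' + m} ‖D^m(Ψ^*g − g_{M,a})(x)‖
≤ C χ^{−p} √dist` on every leaf `0 < τ ≤ T/κ` (`κ = Kerr.surfaceGravity M a`; `D^m` of the zero-extended deviation
`Spacetime.deviationExtend`, as in `deviationCk`). -/
def ThermalTimeOutputW : Prop :=
  ∀ [Kerr.Facts] [Kerr.SliceFacts], ∀ T : ℝ, 0 < T → ∀ k : ℕ, ∀ δ' : ℝ,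
    ∃ (s : ℕ) (δ : ℝ) (γ p a₁ : ℝ), a₁ < 1 ∧
      ∀ (M : ℝ) (hM : 0 < M), ∃ c > (0 : ℝ), ∃ C : ℝ, ∀ a : ℝ, a₁ * M ≤ |a| → Kerr.IsSubextremal M a →
        ∀ (D : InitialDataSet 𝓘(ℝ, E3) (Kerr.slice a M)) [D.metric.HasLeviCivita],
          D.IsVacuumConstraintSolution →
            InitialDataSet.dataWeightedSobolevEDist s δ D (Kerr.data M a M hM.le) <
                ENNReal.ofReal (c * (1 - (a / M) ^ 2) ^ γ) →
              ∀ 𝒟 : VacuumCauchyDevelopment D, 𝒟.IsMaximal →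
                ∃ Ψ : Kerr.region a M → 𝒟.carrier,
                  ContMDiffOn 𝓘(ℝ, E4) (𝓡 4) ∞ Ψ
                    {x | 0 < x.1 0 ∧ x.1 0 < T / Kerr.surfaceGravity M a + 1} ∧
                  Topology.IsOpenEmbedding
                    ({x : Kerr.region a M | 0 < x.1 0 ∧ x.1 0 < T / Kerr.surfaceGravity M a + 1}.restrict Ψ) ∧
                  ContinuousOn Ψ {x | 0 ≤ x.1 0 ∧ x.1 0 < T / Kerr.surfaceGravity M a + 1} ∧
                  (∀ y : Kerr.slice a M,
                    Ψ ⟨E4.ofTimeSpace 0 (y : E3), Kerr.mem_slice_iff_ofTimeSpace_mem_region.1 y.2⟩ =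
                      𝒟.embed y) ∧
                  ∀ τ ∈ Ioc 0 (T / Kerr.surfaceGravity M a),
                    (⨆ (m : ℕ) (_ : m ≤ k),
                      ⨆ x ∈ (Subtype.val '' {x : Kerr.region a M | x.1 0 = τ} : Set E4),
                        ENNReal.ofReal ((1 + Kerr.radius a x) ^ (δ' + (m : ℝ))) *
                          ‖iteratedFDeriv ℝ m
                              (𝒟.toSpacetime.deviationExtend
                                ⟨Kerr.region a M, Kerr.bilin M a, fun x ↦ x 0, Kerr.radius a⟩ Ψ) x‖ₑ) ≤
                      ENNReal.ofReal (C * (1 - (a / M) ^ 2) ^ (-p) *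
                        √(InitialDataSet.dataWeightedSobolevEDist s δ D (Kerr.data M a M hM.le)).toReal)

/-- **S3ʷ · `stub_thermalTimeStabilityW`** — S3 with the weighted hand-over: the resolved family (S1) and the face red-shift
(S2) imply `ThermalTimeOutputW`. Candidate layer-2 item "ThermalTimeCauchyStability" (anchored Einstein-vacuum Cauchy stability
of near-extremal Kerr for one unit of thermal time with polynomial loss, weighted output). Crux-sized; NOT registered. -/
theorem stub_thermalTimeStabilityW : S1 → S2 → ThermalTimeOutputW := by
  sorry

/-- **S4ʷ · `stub_captureTransferW`** — the glue: from the WEIGHTED thermal-time hand-over and the linear floor, capture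
without the sub-extremality conjunct (`CaptureWithoutSub`, equivalent to the crux by `near_iff_withoutSub`). Crux-sized
given its antecedents; NOT registered. -/
theorem stub_captureTransferW :
    ThermalTimeOutputW → KappaExplicitWaveDecay →
    (∀ [Kerr.Facts] [Kerr.SliceFacts], ∃ (s : ℕ) (δ : ℝ) (k : ℕ) (γ p a₁ : ℝ),
      a₁ < 1 ∧ CaptureWithoutSub s δ k γ p a₁) := by
  sorry

/-- The composition for the reshaped line: S1, S2 (landed), S3ʷ, S4ʷ and the linear floor give the crux BY NAME
(same plumbing as rev 2: `near_iff_withoutSub`). -/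
theorem NearExtremalKappaCapture_ofW (h₁ : S1) (h₂ : S2) (h₃ : S1 → S2 → ThermalTimeOutputW)
    (h₄ : type_of% stub_captureTransferW) (hK : KappaExplicitWaveDecay) : NearExtremalKappaCapture := by
  rw [near_iff_withoutSub]
  intro hF hS
  exact @h₄ (h₃ h₁ h₂) hK hF hS

/-- **The weighted bound dominates the unweighted one** (so `S3ʷ ⇒ S3` clause-wise at `δ' = 0`): for weights with exponent
`δ' + m ≥ 0` the factor `(1 + r)^{δ' + m}` is `≥ 1`, hence `deviationCk B Ψ k τ` (the unweighted `Cᵏ` sup over the leaf) is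
at most the weighted supremum over the same leaf. -/
theorem deviationCk_le_weighted {a M : ℝ} (𝓢 : Spacetime 4) (Ψ : Kerr.region a M → 𝓢.carrier) (k : ℕ) (τ δ' : ℝ)
    (hδ' : 0 ≤ δ') :
    𝓢.deviationCk ⟨Kerr.region a M, Kerr.bilin M a, fun x ↦ x 0, Kerr.radius a⟩ Ψ k τ ≤
      ⨆ (m : ℕ) (_ : m ≤ k),
        ⨆ x ∈ (Subtype.val '' {x : Kerr.region a M | x.1 0 = τ} : Set E4),
          ENNReal.ofReal ((1 + Kerr.radius a x) ^ (δ' + (m : ℝ))) *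
            ‖iteratedFDeriv ℝ m
                (𝓢.deviationExtend ⟨Kerr.region a M, Kerr.bilin M a, fun x ↦ x 0, Kerr.radius a⟩ Ψ) x‖ₑ := by
  unfold Spacetime.deviationCk supCkENorm
  refine iSup₂_mono fun m hm ↦ iSup₂_mono fun x hx ↦ ?_
  have hr : 0 ≤ Kerr.radius a x := Kerr.radius_nonneg a x
  have hw : (1 : ℝ) ≤ (1 + Kerr.radius a x) ^ (δ' + (m : ℝ)) :=
    Real.one_le_rpow (by linarith) (by positivity)
  calc ‖iteratedFDeriv ℝ m (𝓢.deviationExtend ⟨Kerr.region a M, Kerr.bilin M a, fun x ↦ x 0, Kerr.radius a⟩ Ψ) x‖ₑ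
      = 1 * ‖iteratedFDeriv ℝ m
          (𝓢.deviationExtend ⟨Kerr.region a M, Kerr.bilin M a, fun x ↦ x 0, Kerr.radius a⟩ Ψ) x‖ₑ := (one_mul _).symm
    _ ≤ ENNReal.ofReal ((1 + Kerr.radius a x) ^ (δ' + (m : ℝ))) * ‖iteratedFDeriv ℝ m
          (𝓢.deviationExtend ⟨Kerr.region a M, Kerr.bilin M a, fun x ↦ x 0, Kerr.radius a⟩ Ψ) x‖ₑ :=
        mul_le_mul_left (ENNReal.one_le_ofReal.2 hw) _

end Summit.FinalStateConjecture.FinalStateConjecture.Cruxes.NearExtremalKappaCapture.UnitTemperatureFrontFace.Weighted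

end
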